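import Summits.QuantumFields.BalabanUV.T4Continuum.Support.NE7CoarseCurlEnergyFlat
import Summits.QuantumFields.BalabanUV.T4Continuum.Support.NE7MinimiserDerivativeFlat
import HarnessLib

/-!
# NE7EffectiveFormKernelFlat — THE NULL SPACE OF THE EFFECTIVE QUADRATIC FORM AT THE FLAT DATUM CONSISTS OF CLOSED COARSE FIELDS (one RG step; ROAD-G115 §9 — the first
# STABILITY statement for Bałaban's variational `Δ` in the tree)

`d = 4`, every `U(n)`, `L ≥ 2`, one averaging step (`j = 0`, coarse period `N`, fine period `L·N`): for `0 < ε ≤ ε₀`, `N ≥ 1` and every coarse direction `v ∈ skewSub N`,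
  `D²(minAct∘chart_1)(0)[v, v] = 0  ⟹  curl_1 ṽ (P) = 0` for every plaquette `P` of the coarse period box (**`effectiveForm_kernel_closed_flat`**):
the `1`-step effective action at the flat background has NO flat directions other than CLOSED ones (linearised pure gauges and harmonic fields) — positivity of Bałaban's `Δ₁` transverse
to closed fields, qualitative form.
MECHANISM: ✓ `NE7MinimiserDerivativeFlat.minimiser_derivative_flat` (the minimiser `H v = ∂_V U|_{V=1} v` has `Q′(Hv) = v` and `w·Σ_p nhsNormSq(curl_1 (Hv) p) = D²m(0)[v,v] = 0`, so `Hv` is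
closed on the fine period box) + ✓ `NE7CoarseCurlEnergyFlat.coarse_curl_energy_le` (coarse Maxwell energy of `Q′X` ≤ fine Maxwell energy of `X` + `C·γ·‖curl X‖_{ℓ²}`, here `= 0`) ⇒ the
coarse Maxwell energy of `v = Q′(Hv)` vanishes.
Cell `pub-balaban`, rung (B)+1 sub-cell t4, lineage `b2b-balaban-t4-ne7-p1` (CRUX PROVER NE7 #1 = OWNER of BINDER row NE7), generation 115.  Memo `t4/b2b-balaban-t4-ne7-p1-g115/ROAD-G115.md` §9–§10.
WHAT ([folklore]; 0 def, 0 sorry).  HONEST FRAMING (page 1): ONE step, FLAT datum, QUALITATIVE (kernel ⊆ closed; no spectral gap constant, no `k`-uniformity, closed ≠ exact not resolved);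
OUR minimisers (B11 (8) with `sfClass`); nothing of Bałaban's asserted; NOT NE7 as a spine node, NOT NE3; spine 0∕9; NOT infinite volume, NOT mass gap, NOT BetaPertH, NOT Clay.
-/

set_option autoImplicit false

open scoped BigOperators Matrix Matrix.Norms.L2Operator Topology
open NormedSpace Finset Set Filter Metric

namespace Summit.QuantumFields.BalabanUV.T4Continuum.NE7EffectiveFormKernelFlat

open Literature.MathematicalPhysics.QuantumFieldTheory.Balaban1983to89
open B7Prop1Explicit B7Prop2Explicit
open T4AveragingDeficitWall (curl curlAt curlSq Ad)
open T4AveragingDeficitWallBoundary (periodBox mem_periodBox)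
open AveragingDeficitTorusChart (TDir chart chartDir)
open AveragingDeficitTwoLevelPrep (skewSub)
open AveragingDeficitMultiLevelPrep (tower levelQ')
open AveragingDeficitTransport (norm_Ad_of_unitary)
open MinimalActionLevels (perWin stepWt stepWt_pos)
open MinimalActionSandwich (minAct)
open MinimalActionRate (sfClass)
open MinimalActionWitness (flatCfg)
open MatrixNorms (nhsNormSq nhsNormSq_nonneg opNorm_sq_le_card_mul_nhsNormSq)
open NE3FlatHessianCurl (isUnitaryCfg_flatCfg)
open NE7CoarseCurlEnergyFlat (coarse_curl_energy_le)
open NE7MinimiserDerivativeFlat (minimiser_derivative_flat)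

noncomputable section

variable {n : Type} [Fintype n] [DecidableEq n]

/-- The flat dressed curl of a bond field is bounded by four sup norms. [folklore] -/
theorem norm_curlAt_flat_le {ψ : Site 4 → Fin 4 → Matrix n n ℂ} {α : ℝ} (hψ : ∀ x κ, ‖ψ x κ‖ ≤ α) (z : Site 4) (μ ν : Fin 4) :
    ‖curlAt (flatCfg : Site 4 → Fin 4 → (Matrix n n ℂ)ˣ) ψ z μ ν‖ ≤ 4 * α := by
  have hU := (isUnitaryCfg_flatCfg (d := 4) (n := n))
  have hu1 : ∀ (u : (Matrix n n ℂ)ˣ), u ∈ unitaryUnits (Matrix n n ℂ) → ∀ X, ‖Ad u X‖ = ‖X‖ := fun u hu X => norm_Ad_of_unitary hu X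
  have h1 := hu1 _ (hU z μ) (ψ z μ)
  have hm : (flatCfg : Site 4 → Fin 4 → (Matrix n n ℂ)ˣ) z μ * (flatCfg : Site 4 → Fin 4 → (Matrix n n ℂ)ˣ) (z + e μ) ν ∈ unitaryUnits (Matrix n n ℂ) :=
    (unitaryUnits _).mul_mem (hU z μ) (hU (z + e μ) ν)
  have h2 := hu1 _ hm (ψ (z + e μ) ν)
  have h3 := hu1 _ hm (ψ (z + e ν) μ)
  have h4 := hu1 _ ((unitaryUnits _).mul_mem hm ((unitaryUnits _).inv_mem (hU (z + e ν) μ))) (ψ z ν)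
  unfold curlAt
  calc _ ≤ ‖Ad (flatCfg z μ) (ψ z μ) + Ad (flatCfg z μ * flatCfg (z + e μ) ν) (ψ (z + e μ) ν) - Ad (flatCfg z μ * flatCfg (z + e μ) ν) (ψ (z + e ν) μ)‖
        + ‖Ad (flatCfg z μ * flatCfg (z + e μ) ν * (flatCfg (z + e ν) μ)⁻¹) (ψ z ν)‖ := norm_sub_le _ _
    _ ≤ ‖Ad (flatCfg z μ) (ψ z μ) + Ad (flatCfg z μ * flatCfg (z + e μ) ν) (ψ (z + e μ) ν)‖ + ‖Ad (flatCfg z μ * flatCfg (z + e μ) ν) (ψ (z + e ν) μ)‖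
        + ‖Ad (flatCfg z μ * flatCfg (z + e μ) ν * (flatCfg (z + e ν) μ)⁻¹) (ψ z ν)‖ := by gcongr; exact norm_sub_le _ _
    _ ≤ ‖Ad (flatCfg z μ) (ψ z μ)‖ + ‖Ad (flatCfg z μ * flatCfg (z + e μ) ν) (ψ (z + e μ) ν)‖ + ‖Ad (flatCfg z μ * flatCfg (z + e μ) ν) (ψ (z + e ν) μ)‖
        + ‖Ad (flatCfg z μ * flatCfg (z + e μ) ν * (flatCfg (z + e ν) μ)⁻¹) (ψ z ν)‖ := by gcongr; exact norm_add_le _ _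
    _ ≤ α + α + α + α := by rw [h1, h2, h3, h4]; gcongr <;> exact hψ _ _
    _ = 4 * α := by ring

set_option maxHeartbeats 1600000 in
/-- **THE NULL SPACE OF THE ONE-STEP EFFECTIVE QUADRATIC FORM AT THE FLAT DATUM CONSISTS OF CLOSED COARSE FIELDS** (see the module docstring). [folklore] -/
theorem effectiveForm_kernel_closed_flat [Nonempty n] {L : ℕ} [NeZero L] (hL : 2 ≤ L) :
    ∃ ε₀ : ℝ, 0 < ε₀ ∧ ∀ ε : ℝ, 0 < ε → ε ≤ ε₀ → ∀ (N : ℕ) [NeZero N], 1 ≤ N → ∀ v : ↥(skewSub 4 n N),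
      fderiv ℝ (fderiv ℝ (fun y : ↥(skewSub 4 n N) => minAct 4 (sfClass 4 L N ε) L N (0 + 1)
        (chart (ContinuousLinearMap.id ℝ (Matrix n n ℂ)) N (flatCfg : Site 4 → Fin 4 → (Matrix n n ℂ)ˣ) (y : TDir 4 n N)))) 0 v v = 0 →
      ∀ P ∈ perWin 4 N, curl (flatCfg : Site 4 → Fin 4 → (Matrix n n ℂ)ˣ) (chartDir (ContinuousLinearMap.id ℝ (Matrix n n ℂ)) N (v : TDir 4 n N)) P = 0 := by
  have hL1 : 1 ≤ L := by omega
  obtain ⟨ε₀, hε₀, H⟩ := minimiser_derivative_flat (n := n) hL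
  refine ⟨ε₀, hε₀, fun ε hε hεle N _ hN v hv0 => ?_⟩
  obtain ⟨Ψ, -, -, -, hH⟩ := H ε hε hεle N hN 0
  obtain ⟨hQ, -, hc⟩ := hH v
  haveI : NeZero (L * N) := ⟨Nat.mul_ne_zero (NeZero.ne L) (NeZero.ne N)⟩
  -- the fine minimiser `H v`, read as a field of period `L·N`
  obtain ⟨Xv, hXv⟩ : ∃ Xv : TDir 4 n (L * N), Xv = ((fderiv ℝ Ψ 0 v : ↥(skewSub 4 n (L * tower L N 0))) : TDir 4 n (L * tower L N 0)) := ⟨_, rfl⟩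
  rw [← hXv] at hQ hc
  have hXmem : Xv ∈ skewSub 4 n (L * N) := by rw [hXv]; exact (fderiv ℝ Ψ 0 v).2
  set XH : ↥(skewSub 4 n (L * N)) := ⟨Xv, hXmem⟩ with hXH
  have hXHval : ((XH : ↥(skewSub 4 n (L * N))) : TDir 4 n (L * N)) = Xv := rfl
  have hcd : chartDir (ContinuousLinearMap.id ℝ (Matrix n n ℂ)) (L * tower L N 0) Xv = chartDir (ContinuousLinearMap.id ℝ (Matrix n n ℂ)) (L * N) Xv := rfl
  set w : ℝ := ((stepWt 4 L)⁻¹) ^ (0 + 1) with hw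
  have hw0 : 0 < w := pow_pos (inv_pos.mpr (stepWt_pos (d := 4) L hL1)) _
  have hper : N * L ^ (0 + 1) = L * N := by ring
  rw [hper, hcd] at hc
  -- the fine minimiser is closed on the fine period box
  have hsum0 : ∑ p ∈ perWin 4 (L * N), nhsNormSq (curl (flatCfg : Site 4 → Fin 4 → (Matrix n n ℂ)ˣ) (chartDir (ContinuousLinearMap.id ℝ (Matrix n n ℂ)) (L * N) Xv) p) = 0 := by
    have h1 : w * ∑ p ∈ perWin 4 (L * N), nhsNormSq (curl (flatCfg : Site 4 → Fin 4 → (Matrix n n ℂ)ˣ) (chartDir (ContinuousLinearMap.id ℝ (Matrix n n ℂ)) (L * N) Xv) p) = 0 := by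
      rw [← hc]; exact hv0
    rcases mul_eq_zero.mp h1 with h | h
    · exact absurd h hw0.ne'
    · exact h
  have hclosed : ∀ p ∈ perWin 4 (L * N), curl (flatCfg : Site 4 → Fin 4 → (Matrix n n ℂ)ˣ) (chartDir (ContinuousLinearMap.id ℝ (Matrix n n ℂ)) (L * N) Xv) p = 0 := by
    intro p hp
    have hterm := (Finset.sum_eq_zero_iff_of_nonneg (fun q _ => nhsNormSq_nonneg _)).mp hsum0 p hp
    have hsq := opNorm_sq_le_card_mul_nhsNormSq (curl (flatCfg : Site 4 → Fin 4 → (Matrix n n ℂ)ˣ) (chartDir (ContinuousLinearMap.id ℝ (Matrix n n ℂ)) (L * N) Xv) p)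
    rw [hterm, mul_zero] at hsq
    have hn : ‖curl (flatCfg : Site 4 → Fin 4 → (Matrix n n ℂ)ˣ) (chartDir (ContinuousLinearMap.id ℝ (Matrix n n ℂ)) (L * N) Xv) p‖ = 0 :=
      le_antisymm (by nlinarith [norm_nonneg (curl (flatCfg : Site 4 → Fin 4 → (Matrix n n ℂ)ˣ) (chartDir (ContinuousLinearMap.id ℝ (Matrix n n ℂ)) (L * N) Xv) p)])
        (norm_nonneg _)
    exact norm_eq_zero.mp hn
  have hcurlSq0 : curlSq (flatCfg : Site 4 → Fin 4 → (Matrix n n ℂ)ˣ) (chartDir (ContinuousLinearMap.id ℝ (Matrix n n ℂ)) (L * N) Xv) (periodBox (d := 4) (L * N)) = 0 := by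
    unfold curlSq
    refine Finset.sum_eq_zero fun z hz => Finset.sum_eq_zero fun π _ => ?_
    have hp : ((z, π) : T4AveragingDeficitWall.Plaq 4) ∈ perWin 4 (L * N) := Finset.mem_product.mpr ⟨hz, Finset.mem_univ _⟩
    rw [hclosed (z, π) hp, norm_zero]; ring
  -- the sup bound of the dressed curl (`γ = 4‖Hv‖`) and the coarse-curl-energy estimate
  set α : ℝ := ‖Xv‖ with hα
  have hXα : ∀ x κ, ‖chartDir (ContinuousLinearMap.id ℝ (Matrix n n ℂ)) (L * N) Xv x κ‖ ≤ α := fun x κ => by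
    simp only [chartDir, ContinuousLinearMap.id_apply]
    exact (norm_le_pi_norm (Xv (AveragingDeficitTorusChart.redN (L * N) x)) κ).trans (norm_le_pi_norm _ _)
  have hγ : ∀ (z : Site 4) (μ ν : Fin 4), μ ≠ ν →
      ‖curlAt (flatCfg : Site 4 → Fin 4 → (Matrix n n ℂ)ˣ) (chartDir (ContinuousLinearMap.id ℝ (Matrix n n ℂ)) (L * N) Xv) z μ ν‖ ≤ 4 * α := fun z μ ν _ =>
    norm_curlAt_flat_le hXα z μ ν
  have hest := coarse_curl_energy_le (n := n) hL1 N hN XH (γ := 4 * α) (by positivity) hγ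
  simp only [hXHval, hcurlSq0, Real.sqrt_zero, mul_zero, add_zero] at hest
  rw [hQ] at hest
  have hsum1 : ∑ P ∈ perWin 4 N, nhsNormSq (curl (flatCfg : Site 4 → Fin 4 → (Matrix n n ℂ)ˣ) (chartDir (ContinuousLinearMap.id ℝ (Matrix n n ℂ)) N (v : TDir 4 n N)) P) = 0 :=
    le_antisymm (hest.trans (le_of_eq hsum0)) (Finset.sum_nonneg fun P _ => nhsNormSq_nonneg _)
  intro P hP
  have hterm := (Finset.sum_eq_zero_iff_of_nonneg (fun q _ => nhsNormSq_nonneg _)).mp hsum1 P hP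
  have hsq := opNorm_sq_le_card_mul_nhsNormSq (curl (flatCfg : Site 4 → Fin 4 → (Matrix n n ℂ)ˣ) (chartDir (ContinuousLinearMap.id ℝ (Matrix n n ℂ)) N (v : TDir 4 n N)) P)
  rw [hterm, mul_zero] at hsq
  have hn : ‖curl (flatCfg : Site 4 → Fin 4 → (Matrix n n ℂ)ˣ) (chartDir (ContinuousLinearMap.id ℝ (Matrix n n ℂ)) N (v : TDir 4 n N)) P‖ = 0 :=
    le_antisymm (by nlinarith [norm_nonneg (curl (flatCfg : Site 4 → Fin 4 → (Matrix n n ℂ)ˣ) (chartDir (ContinuousLinearMap.id ℝ (Matrix n n ℂ)) N (v : TDir 4 n N)) P)])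
      (norm_nonneg _)
  exact norm_eq_zero.mp hn

end

end Summit.QuantumFields.BalabanUV.T4Continuum.NE7EffectiveFormKernelFlat
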